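/-
Copyright (c) 2026. All rights reserved.
Released under Apache 2.0 license as described in the file LICENSE.
Authors: abc-iut cell — seat abc-iut-f-104 (F fact-proving wave, tranche 104: FACT-LIST row F-0183 of
`PanalocalTheaters.lean`, instance form).
-/
import Literature.AnabelianGeometry.AbsoluteAnabelian.PanalocalTheatersGeneric
import HarnessLib

/-!
# [AbsTopIII] Def 5.1 (iv) / Cor 5.2 (v), morphism part (weak form) for a GENERAL context: morphisms of `EA⊚`
# induce morphisms between panalocalizations — the instance form of F-0183

S. Mochizuki, *Topics in absolute anabelian geometry III* [MochizukiAbsTopIII2015], Def 5.1 (ii) p. 115, (iv) p. 116,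
Cor 5.2 (v) p. 120 (manuscript pages as in `PanalocalTheaters.lean`; journal pp. 1090–1093, 1097).

PROOF-ONLY companion (no `def` / `structure` / `instance`) for the FROZEN FACT-LIST row **F-0183**
`PanalocalizationMapsHom` (schema over the interface context `R : GlobalAnabelianContext`; universal closure
REFUTED in `PanalocalTheatersCountermodels.lean`, `not_forall_panalocalizationMapsHom`).  This file proves the
INSTANCE FORM valid for EVERY context satisfying three interface conditions that print supplies and the record
`GlobalAnabelianContext` (abc-iut-L4-t3) leaves free — exactly the three free data the countermodels exploit:

* (H1, `hgen`/`hnon`/`harc`) along every morphism `f : Π₁ ↪ Π₂` of `EA⊚` between admissible objects, `V⊚(f)`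
  respects `⊚ / V^non / V^arc` (print: `V⊚(f)` is induced by the isomorphism of fields `k_NF(Π₁) ≅ k_NF(Π₂) ≅ F̄`);
* (H2, `hβ`) `V⊚(f)` descends to a BIJECTION `V⊚(Π₁)/Aut(Π₁) ≅ V⊚(Π₂)/Aut(Π₂)` (print, Def 5.1 (ii): both sides are
  `≅ V⊚(F_mod)` — "the natural homomorphism `Aut(X) → Aut(F̄)` surjects onto `Gal(F̄/F_mod)`", journal p. 1090, and
  `F_mod` is the field of moduli of `X_F̄`, common to the objects `X₁ = X₂ ×_{F₂} F₁` related by a morphism of `EA⊚`);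
* (H3, `hX`) `X(Π₁, ṽ) ≅ X(Π₂, V⊚(f)(ṽ))` for archimedean `ṽ` (print: `X(Π, v) = X_{ell,v}` of Cor 2.8 is functorial
  in `Π`, and `(X₁)_{v} ≅ (X₂)_{v}` as Aut-holomorphic orbispaces for a base-change covering).

Under (H1)–(H3): `panalocalizationMapsHom_of_mapProVal_descends : PanalocalizationMapsHom R`.  The morphism
`V✠₁ → V✠₂` between panalocalizations `(V✠ᵢ, ψᵢ)` of `V⊚(Πᵢ)` induced by `f` is: `φ_V := ψ₂ ∘ β_f ∘ ψ₁⁻¹`; at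
`v₁ ↦ v₂` nonarchimedean the open injection `(Π₁)_{v₁} ≅ Π_{1,ṽ₁} ↪ Π_{2,V(f)ṽ₁} ≅ Π_{2,ṽ₂} ≅ (Π₂)_{v₂}` (the lifts
`V(f)ṽ₁`, `ṽ₂` of `v₂` are `Aut(Π₂)`-conjugate, `nonempty_decompGrp_equiv_of_toModAut_eq`; the middle arrow is
`exists_isOpenInjection_decompGrp`, Def 5.1 (iii)(a)); at archimedean `v₁ ↦ v₂` the isomorphism
`(X₁)_{v₁} ≅ X(Π₁, ṽ₁) ≅ X(Π₂, V(f)ṽ₁) ≅ X(Π₂, ṽ₂) ≅ (X₂)_{v₂}` (H3 along `f` and along automorphisms of `Π₂`,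
`nonempty_iso_archSpace_of_toModAut_eq`).  "It follows immediately from the definitions that we obtain a natural
panalocalization functor `Th⊚ → Th✠`" (journal p. 1093).

HONEST LABEL: instance form for the cell's own interface record under printed side conditions (R5); the genuine
context is not in the tree, so F-0183 is NOT discharged at the intended model; refereed pre-IUT anabelian geometry;
no side is taken on, and nothing here bears on, [IUTchIII] Cor. 3.12; typed ≠ proved.
-/

set_option autoImplicit false

namespace Literature.AnabelianGeometry.AbsoluteAnabelian

open CategoryTheory Topology

universe u

namespace GlobalAnabelianContext

variable {R : GlobalAnabelianContext.{u}}

/-- Composite of an open injection of profinite groups with isomorphisms on both sides is an open injection.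
[cite: MochizukiAbsTopIII2015, Def 5.6 (i) p. 134] -/
theorem isOpenInjection_comp_equiv {A B C D : ProfiniteGrp.{u}} (e₁ : A ≃ₜ* B) (φ : B →ₜ* C)
    (hφ : IsOpenInjection φ) (e₂ : C ≃ₜ* D) :
    IsOpenInjection ((ContinuousMonoidHom.toContinuousMonoidHom e₂).comp
      (φ.comp (ContinuousMonoidHom.toContinuousMonoidHom e₁))) := by
  refine ⟨e₂.injective.comp (hφ.injective.comp e₁.injective), ?_⟩
  have h : Set.range ((ContinuousMonoidHom.toContinuousMonoidHom e₂).comp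
      (φ.comp (ContinuousMonoidHom.toContinuousMonoidHom e₁))) = e₂ '' Set.range φ := by
    ext d
    constructor
    · rintro ⟨a, rfl⟩
      exact ⟨φ (e₁ a), ⟨e₁ a, rfl⟩, rfl⟩
    · rintro ⟨c, ⟨b, rfl⟩, rfl⟩
      refine ⟨e₁.symm b, ?_⟩
      change e₂ (φ (e₁ (e₁.symm b))) = e₂ (φ b)
      rw [e₁.apply_symm_apply]
  rw [h]
  exact e₂.toHomeomorph.isOpenMap _ hφ.isOpen_range

/-- Along a morphism `f` of `EA⊚` respecting `⊚ / non / arc`, "nonarchimedean" is also reflected: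
`V(f)(v) ∈ V^non ⟹ v ∈ V^non`. [cite: MochizukiAbsTopIII2015, Def 5.1 (ii) p. 115] -/
theorem mem_non_of_mapProVal_mem_non {E₁ E₂ : FundamentalExtension.{u}} (f : E₁ ⟶ E₂) (hf : IsEAHom f)
    (hgen : R.mapProVal f hf (R.proVal E₁).generic = (R.proVal E₂).generic)
    (harc : ∀ v, v ∈ (R.proVal E₁).arc → R.mapProVal f hf v ∈ (R.proVal E₂).arc)
    {v : (R.proVal E₁).carrier} (hv : R.mapProVal f hf v ∈ (R.proVal E₂).non) : v ∈ (R.proVal E₁).non := by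
  rcases (R.proVal E₁).eq_generic_or_mem v with h | h | h
  · rw [h, hgen] at hv
    exact ((R.proVal E₂).generic_notMem_non hv).elim
  · exact h
  · exact ((R.proVal E₂).disjoint_non_arc.notMem_of_mem_right (harc v h) hv).elim

/-- Along a morphism `f` of `EA⊚` respecting `⊚ / non / arc`, "archimedean" is also reflected.
[cite: MochizukiAbsTopIII2015, Def 5.1 (ii) p. 115] -/
theorem mem_arc_of_mapProVal_mem_arc {E₁ E₂ : FundamentalExtension.{u}} (f : E₁ ⟶ E₂) (hf : IsEAHom f)
    (hgen : R.mapProVal f hf (R.proVal E₁).generic = (R.proVal E₂).generic)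
    (hnon : ∀ v, v ∈ (R.proVal E₁).non → R.mapProVal f hf v ∈ (R.proVal E₂).non)
    {v : (R.proVal E₁).carrier} (hv : R.mapProVal f hf v ∈ (R.proVal E₂).arc) : v ∈ (R.proVal E₁).arc := by
  rcases (R.proVal E₁).eq_generic_or_mem v with h | h | h
  · rw [h, hgen] at hv
    exact ((R.proVal E₂).generic_notMem_arc hv).elim
  · exact ((R.proVal E₂).disjoint_non_arc.notMem_of_mem_left (hnon v h) hv).elim
  · exact h

/-- If `X(Π, ṽ) ≅ X(Π, α·ṽ)` for every automorphism `α` of `Π` in `EA⊚` (functoriality of Cor 2.8's `X_{ell,v}`)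
and `Aut(Π)` respects `⊚ / non / arc`, then archimedean elements with the same class in `V⊚(Π)/Aut(Π)` have
isomorphic `X(Π, −)` — the assignment `v ↦ [X(Π, ṽ)]` of Def 5.1 (iv)(c) descends to `V⊚(Π)/Aut(Π)`.
[cite: MochizukiAbsTopIII2015, Def 5.1 (iv) p. 116] -/
theorem nonempty_iso_archSpace_of_toModAut_eq {E : FundamentalExtension.{u}}
    (hgen : ∀ (α : E ≅ E) (hα : IsEAHom α.hom),
      R.mapProVal α.hom hα (R.proVal E).generic = (R.proVal E).generic)
    (hnon : ∀ (α : E ≅ E) (hα : IsEAHom α.hom) (v : (R.proVal E).carrier),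
      v ∈ (R.proVal E).non → R.mapProVal α.hom hα v ∈ (R.proVal E).non)
    (harc : ∀ (α : E ≅ E) (hα : IsEAHom α.hom) (v : (R.proVal E).carrier),
      v ∈ (R.proVal E).arc → R.mapProVal α.hom hα v ∈ (R.proVal E).arc)
    (hX : ∀ (α : E ≅ E) (hα : IsEAHom α.hom) (v : (R.proVal E).arc),
      Nonempty (AutHolOrbispace.Iso (R.archSpace E v)
        (R.archSpace E ⟨R.mapProVal α.hom hα v.1, harc α hα v.1 v.2⟩)))
    {a b : (R.proVal E).arc} (h : R.toModAut E a.1 = R.toModAut E b.1) :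
    Nonempty (AutHolOrbispace.Iso (R.archSpace E a) (R.archSpace E b)) := by
  rw [toModAut_eq_iff] at h
  -- induction over the generated equivalence relation, carrying the membership proofs along
  suffices key : ∀ x y : (R.proVal E).carrier, Relation.EqvGen (R.AutRel E) x y →
      ∀ (hx : x ∈ (R.proVal E).arc) (hy : y ∈ (R.proVal E).arc),
        Nonempty (AutHolOrbispace.Iso (R.archSpace E ⟨x, hx⟩) (R.archSpace E ⟨y, hy⟩)) from
    key a.1 b.1 h a.2 b.2
  intro x y hxy
  induction hxy with
  | rel x y hxy =>
    intro hx hy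
    obtain ⟨α, hα, rfl⟩ := hxy
    exact hX α hα ⟨x, hx⟩
  | refl x => exact fun _ _ => ⟨⟨Homeomorph.refl _, RingEquiv.refl _, ContinuousMulEquiv.refl _⟩⟩
  | symm x y _ ih =>
    intro hx hy
    obtain ⟨i⟩ := ih hy hx
    exact ⟨⟨i.toHomeomorph.symm, i.fieldIso.symm, i.pi1Iso.symm⟩⟩
  | trans x y z hxy _ ih₁ ih₂ =>
    intro hx hz
    have hy : y ∈ (R.proVal E).arc :=
      (mem_arc_iff_of_toModAut_eq hgen hnon harc ((R.toModAut_eq_iff E x y).mpr hxy)).mp hx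
    obtain ⟨i₁⟩ := ih₁ hx hy
    obtain ⟨i₂⟩ := ih₂ hy hz
    exact ⟨⟨i₁.toHomeomorph.trans i₂.toHomeomorph, i₁.fieldIso.trans i₂.fieldIso, i₁.pi1Iso.trans i₂.pi1Iso⟩⟩

end GlobalAnabelianContext

/-- **F-0183 (Def 5.1 (iv) / Cor 5.2 (v), morphism part, weak form) for EVERY context satisfying (H1)–(H3)**:
if along every morphism `f : Π₁ ↪ Π₂` of `EA⊚` between admissible objects `V⊚(f)` respects `⊚ / V^non / V^arc`
(H1), descends to a bijection `β_f : V⊚(Π₁)/Aut(Π₁) ≅ V⊚(Π₂)/Aut(Π₂)` (H2; in print both are `V⊚(F_mod)`), and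
`X(Π₁, ṽ) ≅ X(Π₂, V⊚(f)ṽ)` at archimedean `ṽ` (H3; functoriality of `X_{ell,v}`, Cor 2.8), then `f` induces a
morphism `V✠₁ → V✠₂` between ANY panalocalizations of `V⊚(Π₁)`, `V⊚(Π₂)`: `φ_V := ψ₂ ∘ β_f ∘ ψ₁⁻¹`, open injections
`(Π₁)_{v₁} ≅ Π_{1,ṽ₁} ↪ Π_{2,V(f)ṽ₁} ≅ Π_{2,ṽ₂} ≅ (Π₂)_{v₂}` and isomorphisms
`(X₁)_{v₁} ≅ X(Π₁,ṽ₁) ≅ X(Π₂,V(f)ṽ₁) ≅ X(Π₂,ṽ₂) ≅ (X₂)_{v₂}` ("it follows immediately from the definitions that we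
obtain a natural panalocalization functor `Th⊚ → Th✠`"). The side conditions are NOT consequences of the interface
(`not_forall_panalocalizationMapsHom`). [cite: MochizukiAbsTopIII2015, Def 5.1 (iv) p. 116] -/
theorem panalocalizationMapsHom_of_mapProVal_descends (R : GlobalAnabelianContext.{u})
    (hgen : ∀ {E₁ E₂ : FundamentalExtension.{u}} (f : E₁ ⟶ E₂) (hf : IsEAHom f),
      R.IsAdmissible E₁ → R.IsAdmissible E₂ →
        R.mapProVal f hf (R.proVal E₁).generic = (R.proVal E₂).generic)
    (hnon : ∀ {E₁ E₂ : FundamentalExtension.{u}} (f : E₁ ⟶ E₂) (hf : IsEAHom f),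
      R.IsAdmissible E₁ → R.IsAdmissible E₂ → ∀ v : (R.proVal E₁).carrier,
        v ∈ (R.proVal E₁).non → R.mapProVal f hf v ∈ (R.proVal E₂).non)
    (harc : ∀ {E₁ E₂ : FundamentalExtension.{u}} (f : E₁ ⟶ E₂) (hf : IsEAHom f),
      R.IsAdmissible E₁ → R.IsAdmissible E₂ → ∀ v : (R.proVal E₁).carrier,
        v ∈ (R.proVal E₁).arc → R.mapProVal f hf v ∈ (R.proVal E₂).arc)
    (hβ : ∀ {E₁ E₂ : FundamentalExtension.{u}} (f : E₁ ⟶ E₂) (hf : IsEAHom f),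
      R.IsAdmissible E₁ → R.IsAdmissible E₂ → ∃ β : R.ProValModAut E₁ ≃ R.ProValModAut E₂,
        ∀ v, β (R.toModAut E₁ v) = R.toModAut E₂ (R.mapProVal f hf v))
    (hX : ∀ {E₁ E₂ : FundamentalExtension.{u}} (f : E₁ ⟶ E₂) (hf : IsEAHom f) (h₁ : R.IsAdmissible E₁)
      (h₂ : R.IsAdmissible E₂) (v : (R.proVal E₁).arc),
      Nonempty (AutHolOrbispace.Iso (R.archSpace E₁ v)
        (R.archSpace E₂ ⟨R.mapProVal f hf v.1, harc f hf h₁ h₂ v.1 v.2⟩))) :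
    PanalocalizationMapsHom R := by
  intro E₁ E₂ P₁ P₂ hP₁ hP₂ f hf
  obtain ⟨h₁, ψ₁, hg₁, hn₁, ha₁, hb₁, hc₁⟩ := hP₁
  obtain ⟨h₂, ψ₂, hg₂, hn₂, ha₂, hb₂, hc₂⟩ := hP₂
  obtain ⟨β, hβf⟩ := hβ f hf h₁ h₂
  -- (H1)/(H3) for the automorphisms of `Π₂`
  have hgen₂ : ∀ (α : E₂ ≅ E₂) (hα : IsEAHom α.hom),
      R.mapProVal α.hom hα (R.proVal E₂).generic = (R.proVal E₂).generic := fun α hα => hgen α.hom hα h₂ h₂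
  have hnon₂ : ∀ (α : E₂ ≅ E₂) (hα : IsEAHom α.hom) (v : (R.proVal E₂).carrier),
      v ∈ (R.proVal E₂).non → R.mapProVal α.hom hα v ∈ (R.proVal E₂).non := fun α hα => hnon α.hom hα h₂ h₂
  have harc₂ : ∀ (α : E₂ ≅ E₂) (hα : IsEAHom α.hom) (v : (R.proVal E₂).carrier),
      v ∈ (R.proVal E₂).arc → R.mapProVal α.hom hα v ∈ (R.proVal E₂).arc := fun α hα => harc α.hom hα h₂ h₂
  have hX₂ : ∀ (α : E₂ ≅ E₂) (hα : IsEAHom α.hom) (v : (R.proVal E₂).arc),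
      Nonempty (AutHolOrbispace.Iso (R.archSpace E₂ v)
        (R.archSpace E₂ ⟨R.mapProVal α.hom hα v.1, harc₂ α hα v.1 v.2⟩)) := fun α hα v => hX α.hom hα h₂ h₂ v
  -- chosen lifts of the local elements of the two theaters (conditions (b), (c) of Def 5.1 (iv))
  choose l₁ hl₁_non hl₁_eq hl₁_iso using hb₁
  choose m₁ hm₁_eq hm₁_iso using hc₁
  choose l₂ hl₂_non hl₂_eq hl₂_iso using hb₂
  choose m₂ hm₂_eq hm₂_iso using hc₂
  -- `φ_V := ψ₂ ∘ β ∘ ψ₁⁻¹`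
  let φV : P₁.V ≃ P₂.V := ψ₁.symm.trans (β.trans ψ₂)
  have hφV : ∀ v : (R.proVal E₁).carrier,
      φV (ψ₁ (R.toModAut E₁ v)) = ψ₂ (R.toModAut E₂ (R.mapProVal f hf v)) := fun v => by
    show ψ₂ (β (ψ₁.symm (ψ₁ (R.toModAut E₁ v)))) = _
    rw [Equiv.symm_apply_apply, hβf]
  have hφV_non : ∀ q : P₁.non, φV q ∈ P₂.non := fun q => by
    rw [← hl₁_eq q, hφV]
    exact hn₂ _ (hnon f hf h₁ h₂ _ (hl₁_non q))
  have hφV_arc : ∀ q : P₁.arc, φV q ∈ P₂.arc := fun q => by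
    rw [← hm₁_eq q, hφV]
    exact ha₂ _ (harc f hf h₁ h₂ _ (m₁ q).2)
  -- the image of the lift of `q` and the lift of `φ_V q` are `Aut(Π₂)`-conjugate
  have hcl_non : ∀ q : P₁.non,
      R.toModAut E₂ (R.mapProVal f hf (l₁ q)) = R.toModAut E₂ (l₂ ⟨φV q, hφV_non q⟩) := fun q => by
    apply ψ₂.injective
    rw [← hφV, hl₁_eq, hl₂_eq]
  have hcl_arc : ∀ q : P₁.arc,
      R.toModAut E₂ (R.mapProVal f hf (m₁ q).1) = R.toModAut E₂ (m₂ ⟨φV q, hφV_arc q⟩).1 := fun q => by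
    apply ψ₂.injective
    rw [← hφV, hm₁_eq, hm₂_eq]
  -- open injections `(Π₁)_{v₁} ↪ (Π₂)_{v₂}`
  have hgrp : ∀ q : P₁.non, ∃ g : P₁.grp q →ₜ* P₂.grp ⟨φV q, hφV_non q⟩, IsOpenInjection g := fun q => by
    obtain ⟨e₁⟩ := hl₁_iso q
    obtain ⟨φ₀, hφ₀, -⟩ := GlobalAnabelianContext.exists_isOpenInjection_decompGrp f hf (l₁ q)
    obtain ⟨e₃⟩ := GlobalAnabelianContext.nonempty_decompGrp_equiv_of_toModAut_eq (hcl_non q)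
    obtain ⟨e₂⟩ := hl₂_iso ⟨φV q, hφV_non q⟩
    exact ⟨_, GlobalAnabelianContext.isOpenInjection_comp_equiv e₁ φ₀ hφ₀ (e₃.trans e₂.symm)⟩
  choose g hg using hgrp
  -- isomorphisms `(X₁)_{v₁} ≅ (X₂)_{v₂}`
  have hXq : ∀ q : P₁.arc, Nonempty (AutHolOrbispace.Iso (P₁.X q) (P₂.X ⟨φV q, hφV_arc q⟩)) := fun q => by
    obtain ⟨i₁⟩ := hm₁_iso q
    obtain ⟨i₀⟩ := hX f hf h₁ h₂ (m₁ q)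
    obtain ⟨i₃⟩ := GlobalAnabelianContext.nonempty_iso_archSpace_of_toModAut_eq hgen₂ hnon₂ harc₂ hX₂
      (a := ⟨_, harc f hf h₁ h₂ _ (m₁ q).2⟩) (b := m₂ ⟨φV q, hφV_arc q⟩) (hcl_arc q)
    obtain ⟨i₂⟩ := hm₂_iso ⟨φV q, hφV_arc q⟩
    exact ⟨⟨(i₁.toHomeomorph.trans i₀.toHomeomorph).trans (i₃.toHomeomorph.trans i₂.toHomeomorph.symm),
      (i₁.fieldIso.trans i₀.fieldIso).trans (i₃.fieldIso.trans i₂.fieldIso.symm),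
      (i₁.pi1Iso.trans i₀.pi1Iso).trans (i₃.pi1Iso.trans i₂.pi1Iso.symm)⟩⟩
  refine ⟨{ φV := φV
            φV_generic := ?_
            image_non := ?_
            image_arc := ?_
            non_mem := hφV_non
            arc_mem := hφV_arc
            grpHom := g
            grpHom_isOpenInjection := hg
            archIso := fun q => Classical.choice (hXq q) }⟩
  · -- (a) `⊚ ↦ ⊚`
    rw [← hg₁, hφV, hgen f hf h₁ h₂, hg₂]
  · -- `V^non₁ ≅ V^non₂`
    apply Set.eq_of_subset_of_subset
    · rintro _ ⟨q, hq, rfl⟩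
      exact hφV_non ⟨q, hq⟩
    · intro q₂ hq₂
      obtain ⟨x, hx⟩ := β.surjective (R.toModAut E₂ (l₂ ⟨q₂, hq₂⟩))
      obtain ⟨v₁, rfl⟩ := Quot.exists_rep x
      have hx' : R.toModAut E₂ (R.mapProVal f hf v₁) = R.toModAut E₂ (l₂ ⟨q₂, hq₂⟩) := by rw [← hβf]; exact hx
      have hv₁ : v₁ ∈ (R.proVal E₁).non :=
        GlobalAnabelianContext.mem_non_of_mapProVal_mem_non f hf (hgen f hf h₁ h₂) (harc f hf h₁ h₂)
          ((GlobalAnabelianContext.mem_non_iff_of_toModAut_eq hgen₂ hnon₂ harc₂ hx').mpr (hl₂_non ⟨q₂, hq₂⟩))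
      refine ⟨ψ₁ (R.toModAut E₁ v₁), hn₁ v₁ hv₁, ?_⟩
      rw [hφV, hx', hl₂_eq]
  · -- `V^arc₁ ≅ V^arc₂`
    apply Set.eq_of_subset_of_subset
    · rintro _ ⟨q, hq, rfl⟩
      exact hφV_arc ⟨q, hq⟩
    · intro q₂ hq₂
      obtain ⟨x, hx⟩ := β.surjective (R.toModAut E₂ (m₂ ⟨q₂, hq₂⟩).1)
      obtain ⟨v₁, rfl⟩ := Quot.exists_rep x
      have hx' : R.toModAut E₂ (R.mapProVal f hf v₁) = R.toModAut E₂ (m₂ ⟨q₂, hq₂⟩).1 := by rw [← hβf]; exact hx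
      have hv₁ : v₁ ∈ (R.proVal E₁).arc :=
        GlobalAnabelianContext.mem_arc_of_mapProVal_mem_arc f hf (hgen f hf h₁ h₂) (hnon f hf h₁ h₂)
          ((GlobalAnabelianContext.mem_arc_iff_of_toModAut_eq hgen₂ hnon₂ harc₂ hx').mpr (m₂ ⟨q₂, hq₂⟩).2)
      refine ⟨ψ₁ (R.toModAut E₁ v₁), ha₁ v₁ hv₁, ?_⟩
      rw [hφV, hx', hm₂_eq]

end Literature.AnabelianGeometry.AbsoluteAnabelian
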